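import Summits.QuantumFields.GaugeBoot.FlowSchwingerDyson
import Summits.QuantumFields.GaugeBoot.PeriodicHaarShiftUniqueness
import HarnessLib

/-!
# Schwinger–Dyson states of a product of compact groups: equivalence with the Haar-shift identities, finite-volume uniqueness (gauge-boot, L1 supplement)

HONEST FRAMING (cell `pub-gaugeboot`, page 1 of every file): the venture produces certified bounds
on lattice expectations at stated coupling, gauge group, dimension and torus size; NOT a mass gap,
NOT a continuum limit, NOT a string tension; NOT Yang–Mills-summit-bearing (barriers
`FixedCouplingUltralocality`, `PerturbativeInvisibility`). This module is a structural statement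
about configuration spaces `ι → G`; it certifies no number.

## Content

`IsSchwingerDysonState k S β μ` — the DERIVATIVE form of the loop equations as a property of a
measure `μ` on `ι → G` (`ι` = links, `G` = gauge group): for every link `i` and every member `k a`
of a family of continuous one-parameter subgroups of `G`, the local action `S i` is differentiable
along the left shift `U ↦ U[i ↦ k a (t) · U i]` with a continuous derivative `S'`, and
`∫ f' dμ = β ∫ f S' dμ` for every continuous `f` with a continuous derivative `f'` along that shift
— exactly the shape of the tree's Wilson-measure theorem `integral_shiftDeriv_eq_wilson` and of the
cell's `sd_pair`, the source of every loop-equation row.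

* `isContinuousFlow_update_mul` — one-link shifts are continuous flows (`FlowSchwingerDyson.lean`);
* ★ `IsSchwingerDysonState.integral_comp_update_mul` / `….haarShift` — a Schwinger–Dyson state
  satisfies the finite HAAR-SHIFT IDENTITIES
  `∫ F(U[i ↦ g U_i]) dμ = ∫ F(U) e^{-β (S_i(U[i ↦ g⁻¹ U_i]) - S_i(U))} dμ` for every `g` on the
  one-parameter subgroups of the family (all of `G` when the family exhausts `G`, `hG` — e.g. every
  element of `SU(N)`, `U(N)`, `SO(N)` is an exponential, tree `UnitaryGroupExpSurjective`);
* `isSchwingerDysonState_of_haarShift`, ★ `isSchwingerDysonState_iff_haarShift` — and conversely: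
  THE TWO FORMS OF THE LOOP EQUATIONS ARE EQUIVALENT (any index set `ι` with countably many links,
  any compact metrisable `G`, any real `β`, continuous local actions differentiable along the family);
* `integral_comp_update_mul_pi_tilted` — the Gibbs reweighting `(Haar^{⊗ι}).tilted (-β S)` of a
  finite product satisfies the Haar-shift identities (left invariance of product Haar measure);
* ★★ `eq_pi_tilted_of_sd`, ★★ `eq_pi_tilted_iff_sd` — FINITE VOLUME: a probability measure on a
  finite product `ι → G` is a Schwinger–Dyson state of the continuous action `S` at `β` iff it IS
  `(Haar^{⊗ι}).tilted (-β S)` (via `eq_pi_tilted_of_haarShift`): the derivative-form loop equations,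
  for all test functions differentiable along one-link shifts, have exactly one probability
  solution. The sequel `SchwingerDysonDeterminesWilson.lean` specialises to the Wilson action on
  periodic lattices and to `SU(N)` with the exponential one-parameter subgroups.

References: M. Creutz, *Quarks, gluons and lattices* (1983) Ch. 11; S. Chatterjee,
arXiv:1502.07719 §3; V. Kazakov, Z. Zheng, arXiv:2203.11360 §2; H. Shen, R. Zhu, X. Zhu,
arXiv:2204.12737 §1.2 (Schwinger–Dyson equations as stationarity). Folklore.
-/

noncomputable section

open MeasureTheory
open Literature.MathematicalPhysics.QuantumFieldTheory (haarProbability)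

namespace Summit.QuantumFields.GaugeBoot

variable {ι : Type*} [DecidableEq ι] {G : Type*} [Group G] [TopologicalSpace G] [MeasurableSpace G]
  {K : Type*}

/-- **Schwinger–Dyson state** (derivative form of the loop equations). The measure `μ` on the
configurations `ι → G` satisfies the one-link SCHWINGER–DYSON (integration-by-parts) IDENTITIES of
the local actions `S i` at coupling `β` along the one-parameter subgroups `k a`, `a : K`: for every
link `i` and every `a`, `S i` has a continuous derivative `S'` along the left shift
`U ↦ U[i ↦ k a (t) · U i]` at `t = 0`, and `∫ f' dμ = β ∫ f · S' dμ` for every continuous `f` with a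
continuous derivative `f'` along that shift (the shape of the tree's `integral_shiftDeriv_eq_wilson`).
In finite volume `S i = S` is the full action; on `ℤ^d` `S i` is the action of the plaquettes
containing `i`. [shape] A parametric definition of a proposition — NOT a fact. [folklore] -/
def IsSchwingerDysonState (k : K → ℝ → G) (S : ι → (ι → G) → ℝ) (β : ℝ) (μ : Measure (ι → G)) :
    Prop :=
  ∀ (i : ι) (a : K), ∃ S' : (ι → G) → ℝ, Continuous S' ∧
    (∀ U, HasDerivAt (fun t => S i (Function.update U i (k a t * U i))) (S' U) 0) ∧
    ∀ f f' : (ι → G) → ℝ, Continuous f → Continuous f' →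
      (∀ U, HasDerivAt (fun t => f (Function.update U i (k a t * U i))) (f' U) 0) →
      ∫ U, f' U ∂μ = β * ∫ U, f U * S' U ∂μ

/-! ## One-link shifts along a one-parameter subgroup are continuous flows -/

section Flow

variable [ContinuousMul G]

omit [MeasurableSpace G] in
/-- The left shift of the link `i` along a continuous one-parameter subgroup `k` is a continuous
flow on `ι → G` (`FlowSchwingerDyson.IsContinuousFlow`). [folklore] -/
theorem isContinuousFlow_update_mul {k : ℝ → G} (hkc : Continuous k)
    (hk : ∀ s t, k (s + t) = k s * k t) (i : ι) :
    IsContinuousFlow fun (t : ℝ) (U : ι → G) => Function.update U i (k t * U i) where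
  flow s t U := by
    rw [Function.update_self, Function.update_idem, ← mul_assoc, ← hk]
  map_zero U := by
    have h0 : k 0 = 1 := by
      have h := hk 0 0
      rw [add_zero] at h
      exact mul_eq_left.1 h.symm
    rw [h0, one_mul, Function.update_eq_self]
  continuous :=
    continuous_snd.update i ((hkc.comp continuous_fst).mul ((continuous_apply i).comp continuous_snd))

omit [TopologicalSpace G] [MeasurableSpace G] [ContinuousMul G] in
/-- Along a one-parameter subgroup the shift at time `-t` is the shift by `(k t)⁻¹`. [folklore] -/
theorem update_oneParam_neg {k : ℝ → G} (hk : ∀ s t, k (s + t) = k s * k t) (i : ι) (t : ℝ)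
    (U : ι → G) : Function.update U i (k (-t) * U i) = Function.update U i ((k t)⁻¹ * U i) := by
  have h0 : k 0 = 1 := by
    have h := hk 0 0
    rw [add_zero] at h
    exact mul_eq_left.1 h.symm
  have h := hk (-t) t
  rw [neg_add_cancel, h0] at h
  rw [eq_inv_of_mul_eq_one_left h.symm]

omit [TopologicalSpace G] [MeasurableSpace G] [ContinuousMul G] in
/-- One-link left shifts are left multiplications in the product group:
`U[i ↦ g U_i] = (1[i ↦ g]) · U`. [folklore] -/
theorem update_mul_eq_mulSingle_mul (i : ι) (g : G) (U : ι → G) :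
    Function.update U i (g * U i) = Function.update (1 : ι → G) i g * U := by
  funext j
  by_cases hj : j = i
  · subst hj
    simp
  · simp [hj]

end Flow

/-! ## Schwinger–Dyson identities versus Haar-shift identities -/

section Equivalence

variable [IsTopologicalGroup G] [CompactSpace G] [BorelSpace G] [SecondCountableTopology G]
  [Countable ι] {k : K → ℝ → G} {S : ι → (ι → G) → ℝ} {β : ℝ}

/-- ★ **A Schwinger–Dyson state satisfies the Haar-shift identity along every subgroup of the
family**: `∫ F(U[i ↦ k_a(t) U_i]) dμ = ∫ F(U) e^{-β (S_i(U[i ↦ k_a(t)⁻¹ U_i]) - S_i(U))} dμ` for every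
continuous `F` (averaging trick of `FlowSchwingerDyson.lean`; no differentiability of `F`).
[folklore] -/
theorem IsSchwingerDysonState.integral_comp_update_mul (hkc : ∀ a, Continuous (k a))
    (hk : ∀ a s t, k a (s + t) = k a s * k a t) (hS : ∀ i, Continuous (S i))
    {μ : Measure (ι → G)} [IsFiniteMeasure μ] (hμ : IsSchwingerDysonState k S β μ) (i : ι) (a : K)
    (t : ℝ) (F : (ι → G) → ℝ) (hF : Continuous F) :
    ∫ U, F (Function.update U i (k a t * U i)) ∂μ =
      ∫ U, F U * Real.exp (-(β * (S i (Function.update U i ((k a t)⁻¹ * U i)) - S i U))) ∂μ := by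
  obtain ⟨S', hS'c, hS', hsd⟩ := hμ i a
  have h := (isContinuousFlow_update_mul (hkc a) (hk a) i).integral_comp_flow_eq_integral_mul_exp_of_sd
    μ (hS i) hS'c hS' β (P := fun _ => True) (fun f f' _ hf hf' hd => hsd f f' hf hf' hd) hF t trivial
  simpa only [update_oneParam_neg (hk a)] using h

/-- ★ **A Schwinger–Dyson state is a Haar-shift state** when the family of one-parameter subgroups
exhausts `G` (`hG`: every `g` is some `k_a(t)` — true for the exponentials of `SU(N)`, `U(N)`,
`SO(N)`, `Sp(N)`): `∫ F(U[i ↦ g U_i]) dμ = ∫ F(U) e^{-β (S_i(U[i ↦ g⁻¹ U_i]) - S_i(U))} dμ` for every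
link `i`, every `g ∈ G` and every continuous `F`. [folklore] -/
theorem IsSchwingerDysonState.haarShift (hkc : ∀ a, Continuous (k a))
    (hk : ∀ a s t, k a (s + t) = k a s * k a t) (hG : ∀ g : G, ∃ a t, k a t = g)
    (hS : ∀ i, Continuous (S i)) {μ : Measure (ι → G)} [IsFiniteMeasure μ]
    (hμ : IsSchwingerDysonState k S β μ) (i : ι) (g : G) (F : (ι → G) → ℝ) (hF : Continuous F) :
    ∫ U, F (Function.update U i (g * U i)) ∂μ =
      ∫ U, F U * Real.exp (-(β * (S i (Function.update U i (g⁻¹ * U i)) - S i U))) ∂μ := by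
  obtain ⟨a, t, rfl⟩ := hG g
  exact hμ.integral_comp_update_mul hkc hk hS i a t F hF

/-- **A Haar-shift state is a Schwinger–Dyson state** along every family of continuous
one-parameter subgroups along which the local actions are differentiable with continuous
derivative (`hSd`): differentiate the shift identity at `t = 0` under the integral sign.
[folklore] -/
theorem isSchwingerDysonState_of_haarShift (hkc : ∀ a, Continuous (k a))
    (hk : ∀ a s t, k a (s + t) = k a s * k a t) (hS : ∀ i, Continuous (S i))
    (hSd : ∀ (i : ι) (a : K), ∃ S' : (ι → G) → ℝ, Continuous S' ∧
      ∀ U, HasDerivAt (fun t => S i (Function.update U i (k a t * U i))) (S' U) 0)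
    {μ : Measure (ι → G)} [IsFiniteMeasure μ]
    (h : ∀ (i : ι) (g : G) (F : (ι → G) → ℝ), Continuous F →
      ∫ U, F (Function.update U i (g * U i)) ∂μ =
        ∫ U, F U * Real.exp (-(β * (S i (Function.update U i (g⁻¹ * U i)) - S i U))) ∂μ) :
    IsSchwingerDysonState k S β μ := by
  intro i a
  obtain ⟨S', hS'c, hS'⟩ := hSd i a
  refine ⟨S', hS'c, hS', fun f f' hf hf' hd => ?_⟩
  refine (isContinuousFlow_update_mul (hkc a) (hk a) i).sd_of_forall_integral_comp_flow_eq_integral_mul_exp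
    μ (hS i) hS'c hS' β (fun F hF τ => ?_) hf hf' hd
  simpa only [update_oneParam_neg (hk a)] using h i (k a τ) F hF

/-- ★ **The derivative form and the measure form of the loop equations are EQUIVALENT**: for a
finite measure on `ι → G` (countably many links, `G` compact metrisable), continuous local actions
differentiable along a family of continuous one-parameter subgroups exhausting `G`, and any real
`β`: `μ` is a Schwinger–Dyson state iff it satisfies the one-link Haar-shift identities for every
link, every `g ∈ G` and every continuous observable. [folklore] -/
theorem isSchwingerDysonState_iff_haarShift (hkc : ∀ a, Continuous (k a))
    (hk : ∀ a s t, k a (s + t) = k a s * k a t) (hG : ∀ g : G, ∃ a t, k a t = g)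
    (hS : ∀ i, Continuous (S i))
    (hSd : ∀ (i : ι) (a : K), ∃ S' : (ι → G) → ℝ, Continuous S' ∧
      ∀ U, HasDerivAt (fun t => S i (Function.update U i (k a t * U i))) (S' U) 0)
    (μ : Measure (ι → G)) [IsFiniteMeasure μ] :
    IsSchwingerDysonState k S β μ ↔
      ∀ (i : ι) (g : G) (F : (ι → G) → ℝ), Continuous F →
        ∫ U, F (Function.update U i (g * U i)) ∂μ =
          ∫ U, F U * Real.exp (-(β * (S i (Function.update U i (g⁻¹ * U i)) - S i U))) ∂μ :=
  ⟨fun hμ i g F hF => hμ.haarShift hkc hk hG hS i g F hF,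
    isSchwingerDysonState_of_haarShift hkc hk hS hSd⟩

end Equivalence

/-! ## Finite volume: the Schwinger–Dyson equations determine the Gibbs reweighting of product Haar measure -/

section Finite

variable [IsTopologicalGroup G] [CompactSpace G] [BorelSpace G] [T2Space G]
  [SecondCountableTopology G] [Fintype ι]

omit [T2Space G] [SecondCountableTopology G] in
/-- **The Gibbs reweighting `(Haar^{⊗ι}).tilted (-β S)` of a finite product satisfies the one-link
Haar-shift identities** (left invariance of product Haar measure under `U ↦ (1[i ↦ g]) U`), for
every real `β`, every action `S` and every observable `f` (no continuity needed: a non-integrable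
weight makes both sides vanish). [folklore] -/
theorem integral_comp_update_mul_pi_tilted (S : (ι → G) → ℝ) (β : ℝ) (i : ι) (g : G)
    (f : (ι → G) → ℝ) :
    ∫ U, f (Function.update U i (g * U i))
        ∂((Measure.pi fun _ : ι => haarProbability G).tilted fun U => -β * S U) =
      ∫ U, f U * Real.exp (-(β * (S (Function.update U i (g⁻¹ * U i)) - S U)))
        ∂((Measure.pi fun _ : ι => haarProbability G).tilted fun U => -β * S U) := by
  rw [integral_tilted, integral_tilted]
  set π : Measure (ι → G) := Measure.pi fun _ : ι => haarProbability G with hπ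
  set Z : ℝ := ∫ U, Real.exp (-β * S U) ∂π with hZ
  -- the left side as a left translate of `V ↦ e^{-β S(V[i ↦ g⁻¹ V_i])}/Z • f V`
  have hL : ∀ U : ι → G, (Real.exp (-β * S U) / Z) • f (Function.update U i (g * U i)) =
      (fun V : ι → G => (Real.exp (-β * S (Function.update V i (g⁻¹ * V i))) / Z) • f V)
        (Function.update (1 : ι → G) i g * U) := fun U => by
    simp only [← update_mul_eq_mulSingle_mul]
    rw [Function.update_self, inv_mul_cancel_left, Function.update_idem, Function.update_eq_self]
  simp_rw [hL]
  rw [integral_mul_left_eq_self (fun V : ι → G =>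
    (Real.exp (-β * S (Function.update V i (g⁻¹ * V i))) / Z) • f V) (Function.update (1 : ι → G) i g)]
  refine integral_congr_ae (ae_of_all _ fun V => ?_)
  simp only [smul_eq_mul]
  have e : Real.exp (-β * S V) * Real.exp (-(β * (S (Function.update V i (g⁻¹ * V i)) - S V))) =
      Real.exp (-β * S (Function.update V i (g⁻¹ * V i))) := by
    rw [← Real.exp_add]
    congr 1
    ring
  rw [show Real.exp (-β * S V) / Z * (f V * Real.exp (-(β * (S (Function.update V i (g⁻¹ * V i)) -
      S V)))) = Real.exp (-β * S V) * Real.exp (-(β * (S (Function.update V i (g⁻¹ * V i)) - S V))) /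
      Z * f V by ring, e]

variable [Nonempty G] {k : K → ℝ → G}

/-- ★★ **Finite volume: a Schwinger–Dyson probability state IS the Gibbs reweighting of product
Haar measure.** On the finite product `ι → G` (`G` compact metrisable), with a family of continuous
one-parameter subgroups exhausting `G` and a continuous action `S`: if the probability measure `μ`
satisfies the Schwinger–Dyson identities `∫ f' dμ = β ∫ f S' dμ` along every one-link shift of the
family, then `μ = (Haar^{⊗ι}).tilted (-β S) = e^{-β S} dU / Z` (Haar-shift identities by the averaging
trick, then `eq_pi_tilted_of_haarShift`). [folklore] -/
theorem eq_pi_tilted_of_sd (hkc : ∀ a, Continuous (k a)) (hk : ∀ a s t, k a (s + t) = k a s * k a t)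
    (hG : ∀ g : G, ∃ a t, k a t = g) {S : (ι → G) → ℝ} (hS : Continuous S) {β : ℝ}
    {μ : Measure (ι → G)} [IsProbabilityMeasure μ]
    (hμ : IsSchwingerDysonState k (fun _ => S) β μ) :
    μ = (Measure.pi fun _ : ι => haarProbability G).tilted fun U => -β * S U := by
  refine eq_pi_tilted_of_haarShift (ψ := fun U => -β * S U) (continuous_const.mul hS)
    fun i g f hf => ?_
  rw [hμ.haarShift hkc hk hG (fun _ => hS) i g f hf]
  refine integral_congr_ae (ae_of_all _ fun U => ?_)
  simp only [show ∀ a b : ℝ, -(β * (a - b)) = -β * a - -β * b from fun a b => by ring]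

/-- ★★ **Finite volume: the Schwinger–Dyson equations have exactly one probability solution.**
With a family of continuous one-parameter subgroups exhausting `G` along which the continuous action
`S` is differentiable with continuous derivative: a probability measure on the finite product
`ι → G` is a Schwinger–Dyson state of `S` at `β` iff it is `(Haar^{⊗ι}).tilted (-β S)`. [folklore] -/
theorem eq_pi_tilted_iff_sd (hkc : ∀ a, Continuous (k a)) (hk : ∀ a s t, k a (s + t) = k a s * k a t)
    (hG : ∀ g : G, ∃ a t, k a t = g) {S : (ι → G) → ℝ} (hS : Continuous S)
    (hSd : ∀ (i : ι) (a : K), ∃ S' : (ι → G) → ℝ, Continuous S' ∧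
      ∀ U, HasDerivAt (fun t => S (Function.update U i (k a t * U i))) (S' U) 0)
    (β : ℝ) (μ : Measure (ι → G)) [IsProbabilityMeasure μ] :
    μ = (Measure.pi fun _ : ι => haarProbability G).tilted (fun U => -β * S U) ↔
      IsSchwingerDysonState k (fun _ => S) β μ := by
  refine ⟨fun hμ => ?_, eq_pi_tilted_of_sd hkc hk hG hS⟩
  rw [hμ]
  exact isSchwingerDysonState_of_haarShift hkc hk (fun _ => hS) hSd fun i g F _ =>
    integral_comp_update_mul_pi_tilted S β i g F

end Finite

end Summit.QuantumFields.GaugeBoot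

end
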